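import Mathlib
import Literature.Analysis.Complex.CauchyPompeiu
import Literature.Analysis.Complex.CauchyTransform
import Literature.Analysis.Complex.CauchyTransformBounds
import Literature.Analysis.Complex.CauchyTransformSupport
import Literature.Analysis.Complex.CauchyTransformHolderExtension
import Literature.Analysis.FunctionSpaces.SchauderConstantLaplacian
import Literature.Analysis.FunctionSpaces.HolderAlgebra
import HarnessLib

/-!
# A priori Hölder estimates for the Cauchy transform: auxiliary lemmas

Topic `Literature/Analysis/Complex`. Tools for the a priori `C^{1,r}` estimate of the
one-variable Cauchy transform `T g = cauchyTransformAlong 1 g` of a density supported in a disc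
(`Literature/Analysis/Complex/CauchyTransformHolder.lean`, Vekua's theorem on
`T : C^{0,r} → C^{1,r}`):

* `exists_fderiv_bounds_cauchyTransform` — `T k ∈ C²_b` (bounded first and second derivatives)
  for `k ∈ C²_c`, from the uniform sup bound `‖T h‖_∞ ≤ 6 R ‖h‖_∞` for `h` vanishing off
  `B(0, R)` (`norm_cauchyTransform_le_uniform`,
  `Literature/Analysis/Complex/CauchyTransformHolderExtension.lean`);
* `min_le_rpow_mul_rpow` — `min d ρ ≤ ρ^{1-r} d^r`, the passage from Lipschitz/sup bounds to
  `r`-Hölder bounds;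
* `schauder_laplacian_direction_real` — the constant-coefficient Schauder estimate of the tree
  (`Literature.Analysis.FunctionSpaces.exists_schauder_const_laplacian_direction`,
  Gilbarg–Trudinger Thm. 4.8) on `ℂ ≅ ℝ²`, in real (`‖·‖ ≤ C ‖x - y‖ ^ r`) form;
* `differentiableOn_cauchyTransform_exterior` — `T g` is holomorphic on `{ρ < ‖z‖}` when `g`
  vanishes on `{ρ ≤ ‖z‖}` — and the Cauchy estimates `norm_deriv_cauchyTransform_le`
  (`‖(T g)'‖ ≤ 12 K₀` on `{2ρ ≤ ‖z‖}`), `norm_deriv_deriv_cauchyTransform_le`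
  (`‖(T g)''‖ ≤ 12 K₀ / ρ` on `{3ρ ≤ ‖z‖}`), with the resulting Lipschitz bounds
  `norm_cauchyTransform_sub_le_exterior`, `norm_deriv_cauchyTransform_sub_le` on discs
  `B(z', ρ)`, `‖z'‖ ≥ 4ρ`, and the passage from `deriv` to the real Fréchet derivative
  (`norm_fderiv_real_le_of_differentiableAt`, `norm_fderiv_real_sub_le_of_differentiableAt`).

## References

* D. Gilbarg, N. S. Trudinger, *Elliptic Partial Differential Equations of Second Order* (2001),
  Thm. 4.8. [GilbargTrudinger2001]
* L. Hörmander, *An Introduction to Complex Analysis in Several Variables* (1973), Thm. 1.2.2.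
  [HormanderSCV1973]
-/

noncomputable section

open scoped ContDiff Topology Real NNReal ENNReal Laplacian
open Set Metric MeasureTheory Filter Complex

namespace Literature.Analysis.Complex

variable {F : Type*} [NormedAddCommGroup F] [NormedSpace ℂ F]

/-! ### `T k ∈ C²_b` for `k ∈ C²_c` -/

/-- A real-linear map on `ℂ` is controlled by its values on the real basis `1, i`:
`‖L‖ ≤ ‖L 1‖ + ‖L i‖`. [folklore] -/
theorem opNorm_le_norm_apply_one_add {G' : Type*} [NormedAddCommGroup G'] [NormedSpace ℝ G']
    (L : ℂ →L[ℝ] G') : ‖L‖ ≤ ‖L 1‖ + ‖L I‖ := by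
  refine ContinuousLinearMap.opNorm_le_bound _ (by positivity) fun v => ?_
  have hv : v = v.re • (1 : ℂ) + v.im • I := by
    simp
  calc ‖L v‖ = ‖v.re • L 1 + v.im • L I‖ := by
        conv_lhs => rw [hv]
        rw [map_add, map_smul, map_smul]
    _ ≤ |v.re| * ‖L 1‖ + |v.im| * ‖L I‖ := by
        refine (norm_add_le _ _).trans ?_
        rw [norm_smul, norm_smul, Real.norm_eq_abs, Real.norm_eq_abs]
    _ ≤ ‖v‖ * ‖L 1‖ + ‖v‖ * ‖L I‖ := by
        gcongr
        · exact Complex.abs_re_le_norm v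
        · exact Complex.abs_im_le_norm v
    _ = (‖L 1‖ + ‖L I‖) * ‖v‖ := by ring

/-- The second derivative of the Cauchy transform of `k ∈ C²_c` is the Cauchy transform of the
second derivative: `D²(T k)(x)(a, b) = T (y ↦ D²k(y)(a, b)) (x)` (differentiation under the
integral sign, twice). [cite: HormanderSCV1973, Thm. 1.2.2] -/
theorem fderiv_fderiv_cauchyTransform_apply {k : ℂ → F} (hk : ContDiff ℝ 2 k)
    (hks : HasCompactSupport k) (x a b : ℂ) :
    fderiv ℝ (fderiv ℝ (cauchyTransformAlong 1 k)) x a b =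
      cauchyTransformAlong 1 (fun y => fderiv ℝ (fderiv ℝ k) y a b) x := by
  have hk1 : ContDiff ℝ 1 k := hk.of_le (by norm_num)
  have hT2 : ContDiff ℝ 2 (cauchyTransformAlong 1 k) :=
    contDiff_cauchyTransformAlong hk hks one_ne_zero
  -- `D(T k)(y) b = T (Dk · b)(y)` for all `y`
  have h1 : (fun y => fderiv ℝ (cauchyTransformAlong 1 k) y b) =
      cauchyTransformAlong 1 (fun y => fderiv ℝ k y b) :=
    funext fun y => fderiv_cauchyTransformAlong_apply hk1 hks one_ne_zero y b
  have hkb : ContDiff ℝ 1 (fun y => fderiv ℝ k y b) :=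
    (hk.fderiv_right (m := 1) (by norm_num)).clm_apply contDiff_const
  have hkbs : HasCompactSupport (fun y => fderiv ℝ k y b) := hks.fderiv_apply (𝕜 := ℝ) b
  have hd : DifferentiableAt ℝ (fderiv ℝ (cauchyTransformAlong 1 k)) x :=
    ((hT2.fderiv_right (m := 1) (by norm_num)).differentiable one_ne_zero x)
  have e1 : fderiv ℝ (fderiv ℝ (cauchyTransformAlong 1 k)) x a b =
      fderiv ℝ (fun y => fderiv ℝ (cauchyTransformAlong 1 k) y b) x a := by
    rw [fderiv_clm_apply hd (differentiableAt_const b)]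
    simp
  rw [e1, h1, fderiv_cauchyTransformAlong_apply hkb hkbs one_ne_zero x a]
  congr 1
  funext y
  have hdk : DifferentiableAt ℝ (fderiv ℝ k) y :=
    ((hk.fderiv_right (m := 1) (by norm_num)).differentiable one_ne_zero y)
  rw [fderiv_clm_apply hdk (differentiableAt_const b)]
  simp

/-- **`T k ∈ C²_b` for `k ∈ C²_c`**: the first and second derivatives of the Cauchy transform of a
compactly supported `C²` function are bounded (they are Cauchy transforms of the compactly
supported derivatives of `k`). [folklore] -/
theorem exists_fderiv_bounds_cauchyTransform {k : ℂ → F} (hk : ContDiff ℝ 2 k)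
    (hks : HasCompactSupport k) :
    ∃ M₁ M₂ : ℝ, (∀ x, ‖fderiv ℝ (cauchyTransformAlong 1 k) x‖ ≤ M₁) ∧
      ∀ x, ‖iteratedFDeriv ℝ 2 (cauchyTransformAlong 1 k) x‖ ≤ M₂ := by
  have hk1 : ContDiff ℝ 1 k := hk.of_le (by norm_num)
  -- a radius containing the support of `k` and of its derivatives
  obtain ⟨R₀, hR₀⟩ := hks.isCompact.isBounded.subset_closedBall 0
  set R : ℝ := max R₀ 0 + 1 with hR
  have hRpos : 0 < R := by rw [hR]; positivity
  have hsuppR : ∀ z, z ∈ tsupport k → ‖z‖ < R := fun z hz => by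
    have := hR₀ hz
    rw [mem_closedBall, dist_zero_right] at this
    rw [hR]
    linarith [le_max_left R₀ 0]
  -- sup bounds of `Dk` and `D²k`
  obtain ⟨S₁, hS₁⟩ := (hk.continuous_fderiv (by norm_num)).bounded_above_of_compact_support
    (hks.fderiv ℝ)
  obtain ⟨S₂, hS₂⟩ :=
    (hk.continuous_iteratedFDeriv (m := 2) le_rfl).bounded_above_of_compact_support
      (hks.iteratedFDeriv (𝕜 := ℝ) 2)
  have hS₁0 : 0 ≤ S₁ := (norm_nonneg _).trans (hS₁ 0)
  have hS₂0 : 0 ≤ S₂ := (norm_nonneg _).trans (hS₂ 0)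
  refine ⟨6 * R * S₁ * 2, 6 * R * S₂, fun x => ?_, fun x => ?_⟩
  · -- first derivative
    have hw : ∀ w : ℂ, ‖fderiv ℝ (cauchyTransformAlong 1 k) x w‖ ≤ 6 * R * (S₁ * ‖w‖) := by
      intro w
      rw [fderiv_cauchyTransformAlong_apply hk1 hks one_ne_zero x w]
      refine norm_cauchyTransform_le_uniform hRpos.le (by positivity) (fun z hz => ?_)
        (fun z => ?_) x
      · refine hsuppR z (tsupport_fderiv_subset ℝ (subset_tsupport _ ?_))
        intro h0
        exact hz (by simp [h0])
      · exact ((fderiv ℝ k z).le_opNorm w).trans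
          (mul_le_mul_of_nonneg_right (hS₁ z) (norm_nonneg _))
    refine (opNorm_le_norm_apply_one_add _).trans ?_
    have h1 := hw 1
    have h2 := hw I
    rw [norm_one] at h1
    rw [Complex.norm_I] at h2
    linarith
  · -- second derivative
    refine ContinuousMultilinearMap.opNorm_le_bound (by positivity) fun m => ?_
    rw [Fin.prod_univ_two, iteratedFDeriv_two_apply, fderiv_fderiv_cauchyTransform_apply hk hks]
    have hmul : 6 * R * S₂ * (‖m 0‖ * ‖m 1‖) = 6 * R * (S₂ * ‖m 0‖ * ‖m 1‖) := by ring
    rw [hmul]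
    refine norm_cauchyTransform_le_uniform hRpos.le (by positivity) (fun z hz => ?_)
      (fun z => ?_) x
    · refine hsuppR z ?_
      have h2 : z ∈ Function.support (iteratedFDeriv ℝ 2 k) := by
        intro h0
        apply hz
        have e := iteratedFDeriv_two_apply (𝕜 := ℝ) k z ![m 0, m 1]
        simp only [Matrix.cons_val_zero, Matrix.cons_val_one, Matrix.cons_val_fin_one] at e
        rw [← e, h0, _root_.zero_apply]
      exact tsupport_iteratedFDeriv_subset 2 (subset_tsupport _ h2)
    · have h := (iteratedFDeriv ℝ 2 k z).le_opNorm ![m 0, m 1]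
      rw [Fin.prod_univ_two, iteratedFDeriv_two_apply] at h
      simp only [Matrix.cons_val_zero, Matrix.cons_val_one, Matrix.cons_val_fin_one] at h
      calc ‖fderiv ℝ (fderiv ℝ k) z (m 0) (m 1)‖ ≤ ‖iteratedFDeriv ℝ 2 k z‖ * (‖m 0‖ * ‖m 1‖) := h
        _ ≤ S₂ * (‖m 0‖ * ‖m 1‖) := mul_le_mul_of_nonneg_right (hS₂ z) (by positivity)
        _ = S₂ * ‖m 0‖ * ‖m 1‖ := by ring

/-! ### Hölder bookkeeping -/

/-- `min d ρ ≤ ρ ^ (1 - r) d ^ r` for `d ≥ 0`, `ρ > 0`, `0 ≤ r ≤ 1`: the elementary inequality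
converting Lipschitz bounds at small scales and sup bounds at large scales into `r`-Hölder bounds.
[folklore] -/
theorem min_le_rpow_mul_rpow {d ρ r : ℝ} (hd : 0 ≤ d) (hρ : 0 < ρ) (hr0 : 0 ≤ r) (hr1 : r ≤ 1) :
    min d ρ ≤ ρ ^ (1 - r) * d ^ r := by
  rcases le_or_gt d ρ with h | h
  · rw [min_eq_left h]
    rcases hd.eq_or_lt with h0 | h0
    · rw [← h0]
      positivity
    · calc d = d ^ (1 - r) * d ^ r := by
            rw [← Real.rpow_add h0, sub_add_cancel, Real.rpow_one]
        _ ≤ ρ ^ (1 - r) * d ^ r := by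
            gcongr
  · rw [min_eq_right h.le]
    calc ρ = ρ ^ (1 - r) * ρ ^ r := by
          rw [← Real.rpow_add hρ, sub_add_cancel, Real.rpow_one]
      _ ≤ ρ ^ (1 - r) * d ^ r := by gcongr

/-! ### The constant-coefficient Schauder estimate on `ℂ`, real form -/

/-- **The Schauder estimate for `Δ` on `ℂ ≅ ℝ²` in real form.** For `0 < r < 1` and directions
`a, b ∈ ℂ` there is `C ≥ 0` such that for every `u ∈ C²_b(ℂ, F)` whose Laplacian satisfies
`‖Δu(x) - Δu(y)‖ ≤ L ‖x - y‖ ^ r`: `‖D²u(x)(a, b) - D²u(y)(a, b)‖ ≤ C (‖u‖_∞ + L) ‖x - y‖ ^ r`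
(the tree's `exists_schauder_const_laplacian_direction`, converted from `edist` form).
[cite: GilbargTrudinger2001, Thm. 4.8] -/
theorem schauder_laplacian_direction_real [CompleteSpace F] {r : ℝ≥0} (hr : 0 < r) (hr1 : r < 1)
    (a b : ℂ) :
    ∃ C : ℝ, 0 ≤ C ∧ ∀ (u : ℂ → F) (M₀ M₁ M₂ L : ℝ), 0 ≤ M₀ → 0 ≤ L → ContDiff ℝ 2 u →
      (∀ x, ‖u x‖ ≤ M₀) → (∀ x, ‖fderiv ℝ u x‖ ≤ M₁) → (∀ x, ‖iteratedFDeriv ℝ 2 u x‖ ≤ M₂) →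
      (∀ x y, ‖Δ u x - Δ u y‖ ≤ L * ‖x - y‖ ^ (r : ℝ)) →
      ∀ x y, ‖fderiv ℝ (fderiv ℝ u) x a b - fderiv ℝ (fderiv ℝ u) y a b‖ ≤
        C * (M₀ + L) * ‖x - y‖ ^ (r : ℝ) := by
  obtain ⟨C, hCtop, hC⟩ :=
    Literature.Analysis.FunctionSpaces.exists_schauder_const_laplacian_direction
      (E := ℂ) (F := F) hr hr1 a b
  refine ⟨C.toReal, ENNReal.toReal_nonneg, fun u M₀ M₁ M₂ L hM₀ hL hu h0 h1 h2 hΔ x y => ?_⟩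
  have hH : HolderWith L.toNNReal r (Δ u) := by
    refine Literature.Analysis.FunctionSpaces.holderWith_of_dist_le fun x' y' => ?_
    rw [dist_eq_norm, dist_eq_norm, Real.coe_toNNReal _ hL]
    exact hΔ x' y'
  have key := hC u M₀ M₁ M₂ L.toNNReal hu h0 h1 h2 hH x y
  have e2 : ∀ z, iteratedFDeriv ℝ 2 u z ![a, b] = fderiv ℝ (fderiv ℝ u) z a b := fun z => by
    rw [iteratedFDeriv_two_apply]
    simp
  rw [e2, e2, edist_dist, edist_dist, dist_eq_norm, dist_eq_norm,
    ENNReal.ofReal_rpow_of_nonneg (norm_nonneg _) r.coe_nonneg,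
    ← ENNReal.ofReal_toReal hCtop.ne, ← ENNReal.ofReal_coe_nnreal, Real.coe_toNNReal _ hL,
    ← ENNReal.ofReal_add hM₀ hL, ← ENNReal.ofReal_mul ENNReal.toReal_nonneg,
    ← ENNReal.ofReal_mul (by positivity)] at key
  exact (ENNReal.ofReal_le_ofReal_iff (by positivity)).1 key

/-! ### The Cauchy transform off the support: holomorphy and Cauchy estimates -/

section Exterior

variable [CompleteSpace F]

omit [NormedSpace ℂ F] [CompleteSpace F] in
/-- A function vanishing on `{ρ ≤ ‖z‖}` has compact support. [folklore] -/
theorem hasCompactSupport_of_eq_zero_of_le_norm {g : ℂ → F} {ρ : ℝ}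
    (h0 : ∀ z, ρ ≤ ‖z‖ → g z = 0) : HasCompactSupport g :=
  HasCompactSupport.intro (isCompact_closedBall 0 ρ) fun z hz =>
    h0 z (by rw [mem_closedBall, dist_zero_right, not_le] at hz; exact hz.le)

omit [NormedSpace ℂ F] [CompleteSpace F] in
/-- A function vanishing on `{ρ ≤ ‖z‖}` is nonzero only on `B(0, ρ)`. [folklore] -/
theorem norm_lt_of_ne_zero_of_eq_zero_of_le_norm {g : ℂ → F} {ρ : ℝ}
    (h0 : ∀ z, ρ ≤ ‖z‖ → g z = 0) (z : ℂ) (hz : g z ≠ 0) : ‖z‖ < ρ := by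
  by_contra h
  exact hz (h0 z (le_of_not_gt h))

/-- **`T g` is holomorphic off the support**: if the continuous density `g` vanishes on
`{ρ ≤ ‖z‖}`, then `T g` is complex-differentiable on the open exterior `{ρ < ‖z‖}`.
[cite: HormanderSCV1973, Thm. 1.2.2] -/
theorem differentiableOn_cauchyTransform_exterior {g : ℂ → F} (hg : Continuous g) {ρ : ℝ}
    (h0 : ∀ z, ρ ≤ ‖z‖ → g z = 0) :
    DifferentiableOn ℂ (cauchyTransformAlong 1 g) {z | ρ < ‖z‖} := by
  intro c hc
  rw [mem_setOf_eq] at hc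
  have hgc := hasCompactSupport_of_eq_zero_of_le_norm h0
  have hzero : ∀ z ∈ ball c (‖c‖ - ρ), g z = 0 := fun z hz => by
    apply h0
    rw [mem_ball, dist_eq_norm, norm_sub_rev] at hz
    have := norm_sub_norm_le c z
    linarith
  have hlt : (‖c‖ - ρ) / 2 < ‖c‖ - ρ := by linarith
  have hd := SimilarityVector.differentiableOn_cauchyTransform_of_eq_zero hg hgc hlt hzero
  exact (hd.differentiableAt
    (isOpen_ball.mem_nhds (mem_ball_self (by linarith)))).differentiableWithinAt

/-- **Cauchy estimate for `(T g)'` off the support.** If `g` is continuous, `‖g‖ ≤ K₀`, and `g`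
vanishes on `{ρ ≤ ‖z‖}`, then `‖(T g)'(w)‖ ≤ 12 K₀` for `‖w‖ ≥ 2ρ` (Cauchy's estimate on the
circle `|z - w| = ρ/2`, where `‖T g‖ ≤ 6 ρ K₀`). [folklore] -/
theorem norm_deriv_cauchyTransform_le {g : ℂ → F} (hg : Continuous g) {ρ K₀ : ℝ} (hρ : 0 < ρ)
    (hK₀ : 0 ≤ K₀) (h0 : ∀ z, ρ ≤ ‖z‖ → g z = 0) (hb : ∀ z, ‖g z‖ ≤ K₀) {w : ℂ}
    (hw : 2 * ρ ≤ ‖w‖) : ‖deriv (cauchyTransformAlong 1 g) w‖ ≤ 12 * K₀ := by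
  have hD := differentiableOn_cauchyTransform_exterior hg h0
  have hsub : closedBall w (ρ / 2) ⊆ {z : ℂ | ρ < ‖z‖} := fun z hz => by
    rw [mem_closedBall, dist_eq_norm, norm_sub_rev] at hz
    rw [mem_setOf_eq]
    have := norm_sub_norm_le w z
    linarith
  have key := Complex.norm_deriv_le_of_forall_mem_sphere_norm_le (half_pos hρ)
    (hD.diffContOnCl_ball hsub) (C := 6 * ρ * K₀) fun z _ =>
      norm_cauchyTransform_le_uniform hρ.le hK₀ (norm_lt_of_ne_zero_of_eq_zero_of_le_norm h0) hb z
  calc ‖deriv (cauchyTransformAlong 1 g) w‖ ≤ 6 * ρ * K₀ / (ρ / 2) := key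
    _ = 12 * K₀ := by field_simp; ring

/-- `(T g)'` is holomorphic on the open exterior `{ρ < ‖z‖}` as well. [folklore] -/
theorem differentiableOn_deriv_cauchyTransform_exterior {g : ℂ → F} (hg : Continuous g) {ρ : ℝ}
    (h0 : ∀ z, ρ ≤ ‖z‖ → g z = 0) :
    DifferentiableOn ℂ (deriv (cauchyTransformAlong 1 g)) {z | ρ < ‖z‖} :=
  have hO : IsOpen {z : ℂ | ρ < ‖z‖} := isOpen_lt continuous_const continuous_norm
  ((differentiableOn_cauchyTransform_exterior hg h0).analyticOnNhd hO).deriv.differentiableOn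

/-- **Cauchy estimate for `(T g)''` off the support**: `‖(T g)''(w)‖ ≤ 12 K₀ / ρ` for
`‖w‖ ≥ 3ρ` (Cauchy's estimate for `(T g)'` on the circle `|z - w| = ρ`). [folklore] -/
theorem norm_deriv_deriv_cauchyTransform_le {g : ℂ → F} (hg : Continuous g) {ρ K₀ : ℝ}
    (hρ : 0 < ρ) (hK₀ : 0 ≤ K₀) (h0 : ∀ z, ρ ≤ ‖z‖ → g z = 0) (hb : ∀ z, ‖g z‖ ≤ K₀) {w : ℂ}
    (hw : 3 * ρ ≤ ‖w‖) : ‖deriv (deriv (cauchyTransformAlong 1 g)) w‖ ≤ 12 * K₀ / ρ := by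
  have hD' := differentiableOn_deriv_cauchyTransform_exterior hg h0
  have hsub : closedBall w ρ ⊆ {z : ℂ | ρ < ‖z‖} := fun z hz => by
    rw [mem_closedBall, dist_eq_norm, norm_sub_rev] at hz
    rw [mem_setOf_eq]
    have := norm_sub_norm_le w z
    linarith
  refine Complex.norm_deriv_le_of_forall_mem_sphere_norm_le hρ (hD'.diffContOnCl_ball hsub)
    fun z hz => norm_deriv_cauchyTransform_le hg hρ hK₀ h0 hb ?_
  rw [mem_sphere, dist_eq_norm, norm_sub_rev] at hz
  have := norm_sub_norm_le w z
  linarith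

/-- **Exterior Lipschitz bound for `(T g)'`.** For `‖z'‖ ≥ 4ρ` and `‖z - z'‖ < ρ`:
`‖(T g)'(z) - (T g)'(z')‖ ≤ (12 K₀ / ρ) ‖z - z'‖` (mean value inequality on the disc `B(z', ρ)`,
which lies in `{3ρ < ‖·‖}`). [folklore] -/
theorem norm_deriv_cauchyTransform_sub_le {g : ℂ → F} (hg : Continuous g) {ρ K₀ : ℝ}
    (hρ : 0 < ρ) (hK₀ : 0 ≤ K₀) (h0 : ∀ z, ρ ≤ ‖z‖ → g z = 0) (hb : ∀ z, ‖g z‖ ≤ K₀) {z z' : ℂ}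
    (hz' : 4 * ρ ≤ ‖z'‖) (hzz' : ‖z - z'‖ < ρ) :
    ‖deriv (cauchyTransformAlong 1 g) z - deriv (cauchyTransformAlong 1 g) z'‖ ≤
      12 * K₀ / ρ * ‖z - z'‖ := by
  have hD' := differentiableOn_deriv_cauchyTransform_exterior hg h0
  have hO : IsOpen {z : ℂ | ρ < ‖z‖} := isOpen_lt continuous_const continuous_norm
  have hball : ∀ x ∈ ball z' ρ, 3 * ρ < ‖x‖ := fun x hx => by
    rw [mem_ball, dist_eq_norm, norm_sub_rev] at hx
    have := norm_sub_norm_le z' x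
    linarith
  refine Convex.norm_image_sub_le_of_norm_deriv_le (s := ball z' ρ)
    (f := deriv (cauchyTransformAlong 1 g)) (fun x hx => ?_) (fun x hx => ?_) (convex_ball z' ρ)
    (mem_ball_self hρ) (by rwa [mem_ball, dist_eq_norm])
  · exact hD'.differentiableAt (hO.mem_nhds (by rw [mem_setOf_eq]; linarith [hball x hx]))
  · exact norm_deriv_deriv_cauchyTransform_le hg hρ hK₀ h0 hb (hball x hx).le

/-- **Exterior Lipschitz bound for `T g`.** For `‖z'‖ ≥ 4ρ` and `‖z - z'‖ < ρ`:
`‖(T g)(z) - (T g)(z')‖ ≤ 12 K₀ ‖z - z'‖` (mean value inequality on `B(z', ρ)`). [folklore] -/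
theorem norm_cauchyTransform_sub_le_exterior {g : ℂ → F} (hg : Continuous g) {ρ K₀ : ℝ}
    (hρ : 0 < ρ) (hK₀ : 0 ≤ K₀) (h0 : ∀ z, ρ ≤ ‖z‖ → g z = 0) (hb : ∀ z, ‖g z‖ ≤ K₀) {z z' : ℂ}
    (hz' : 4 * ρ ≤ ‖z'‖) (hzz' : ‖z - z'‖ < ρ) :
    ‖cauchyTransformAlong 1 g z - cauchyTransformAlong 1 g z'‖ ≤ 12 * K₀ * ‖z - z'‖ := by
  have hD := differentiableOn_cauchyTransform_exterior hg h0
  have hO : IsOpen {z : ℂ | ρ < ‖z‖} := isOpen_lt continuous_const continuous_norm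
  have hball : ∀ x ∈ ball z' ρ, 3 * ρ < ‖x‖ := fun x hx => by
    rw [mem_ball, dist_eq_norm, norm_sub_rev] at hx
    have := norm_sub_norm_le z' x
    linarith
  refine Convex.norm_image_sub_le_of_norm_deriv_le (s := ball z' ρ)
    (f := cauchyTransformAlong 1 g) (fun x hx => ?_) (fun x hx => ?_) (convex_ball z' ρ)
    (mem_ball_self hρ) (by rwa [mem_ball, dist_eq_norm])
  · exact hD.differentiableAt (hO.mem_nhds (by rw [mem_setOf_eq]; linarith [hball x hx]))
  · exact norm_deriv_cauchyTransform_le hg hρ hK₀ h0 hb (by linarith [hball x hx])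

omit [CompleteSpace F] in
/-- For a complex-differentiable `G`, the real Fréchet derivative is `v ↦ v • G'(z)`.
[folklore] -/
theorem fderiv_real_apply_of_differentiableAt {G : ℂ → F} {z : ℂ} (h : DifferentiableAt ℂ G z)
    (v : ℂ) : fderiv ℝ G z v = v • deriv G z := by
  rw [h.fderiv_restrictScalars ℝ, ContinuousLinearMap.coe_restrictScalars', fderiv_eq_smul_deriv]

omit [CompleteSpace F] in
/-- `‖D G(z)‖ ≤ ‖G'(z)‖` for complex-differentiable `G` (real operator norm). [folklore] -/
theorem norm_fderiv_real_le_of_differentiableAt {G : ℂ → F} {z : ℂ}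
    (h : DifferentiableAt ℂ G z) : ‖fderiv ℝ G z‖ ≤ ‖deriv G z‖ := by
  refine ContinuousLinearMap.opNorm_le_bound _ (norm_nonneg _) fun v => ?_
  rw [fderiv_real_apply_of_differentiableAt h, norm_smul, mul_comm]

omit [CompleteSpace F] in
/-- `‖D G(z) - D G(z')‖ ≤ ‖G'(z) - G'(z')‖` for complex-differentiable `G`. [folklore] -/
theorem norm_fderiv_real_sub_le_of_differentiableAt {G : ℂ → F} {z z' : ℂ}
    (h : DifferentiableAt ℂ G z) (h' : DifferentiableAt ℂ G z') :
    ‖fderiv ℝ G z - fderiv ℝ G z'‖ ≤ ‖deriv G z - deriv G z'‖ := by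
  refine ContinuousLinearMap.opNorm_le_bound _ (norm_nonneg _) fun v => ?_
  rw [_root_.sub_apply, fderiv_real_apply_of_differentiableAt h,
    fderiv_real_apply_of_differentiableAt h', ← smul_sub, norm_smul, mul_comm]

/-- `T g` is complex-differentiable at every point of the open exterior. [folklore] -/
theorem differentiableAt_cauchyTransform_exterior {g : ℂ → F} (hg : Continuous g) {ρ : ℝ}
    (h0 : ∀ z, ρ ≤ ‖z‖ → g z = 0) {z : ℂ} (hz : ρ < ‖z‖) :
    DifferentiableAt ℂ (cauchyTransformAlong 1 g) z :=
  (differentiableOn_cauchyTransform_exterior hg h0).differentiableAt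
    ((isOpen_lt continuous_const continuous_norm).mem_nhds hz)

end Exterior

end Literature.Analysis.Complex
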